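import Literature.NumberTheory.GaloisRepresentations.ShapiroInjective
import Literature.NumberTheory.GaloisRepresentations.CohomologicalDimensionProofs
import HarnessLib

/-!
# Shapiro's lemma as an isomorphism: `Hⁿ(G, M_G^S(A)) ≃+ Hⁿ(S, A)` (Serre I §2.5 Prop. 10)

Topic `NumberTheory/GaloisRepresentations` (continuous cochain cohomology); namespace
`Literature.NumberTheory.GaloisRepresentations`. One definition with body (the isomorphism) and
theorems; no named fact, no `sorry`, no instance, no notation.

For a closed subgroup `S` of a profinite group `G` and a discrete `S`-module `A`, the Shapiro map
`sh : Hⁿ(G, M_G^S(A)) → Hⁿ(S, A)` induced by "valeur au point `1`" (Mathlib's functoriality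
`ContinuousCohomology.map (S ↪ G) (coindEvalOne σ) n`) is an isomorphism in every degree `n`
(Serre, *Cohomologie galoisienne*, I §2.5 Prop. 10; Shatz II §2 Thm. 8). Both halves are already
in the tree, at cochain level:

* surjectivity — `sh ∘ ext = id` for the extension map built from a continuous equivariant
  retraction `G → S` (`CohomologicalDimensionProofs.extCochainsMap_comp_cochainsMap`, Serre I §1.2
  Prop. 1 + §2.5);
* injectivity in degrees `≥ 1` — `ShapiroInjective.map_shapiro_eq_zero_imp` (dimension shifting).

This file adds injectivity in degree `0` (`H⁰(G, M_G^S(A)) = M_G^S(A)^G = A^S`, a direct check: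
`shapiro_map_zero_injective`), packages the two halves as `shapiro_map_injective` /
`shapiro_map_surjective` / `shapiro_map_bijective`, and records the isomorphism
`shapiroAddEquiv σ n : Hⁿ(G, M_G^S(A)) ≃+ Hⁿ(S, A)` (`Nonempty` form:
`nonempty_continuousCohomology_coindRep_addEquiv`). Consumer: the discharge of Greenberg 2006
Thm. 3 (`IwasawaTheory/Greenberg2006/InducedCohomologyComparisonHolds.lean`).

## References
* J.-P. Serre, *Cohomologie galoisienne*, 5e éd., LNM 5 (1994) / *Galois Cohomology* (1997),
  I §2.5 Prop. 10 (and I §1.2 Prop. 1 for the continuous section). [SerreGaloisCohomology1997]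
* S. S. Shatz, *Profinite groups, arithmetic, and geometry* (1972), Ch. II §2 Thm. 8
  (Faddeev–Shapiro). [Shatz1972]
-/

noncomputable section

open CategoryTheory

universe u

namespace Literature.NumberTheory.GaloisRepresentations

open _root_.TopRep _root_.ContRepresentation _root_.ContinuousCohomology

variable {G : Type u} [Group G] [TopologicalSpace G] [IsTopologicalGroup G] [CompactSpace G]
  [T2Space G] [TotallyDisconnectedSpace G]
variable {S : Subgroup G} [hS : IsClosed (S : Set G)]
variable {A : Type u} [AddCommGroup A] [TopologicalSpace A] [DiscreteTopology A]
  (σ : ContinuousRep S ℤ A)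

omit [T2Space G] [TotallyDisconnectedSpace G] hS in
/-- **Shapiro injectivity in degree `0`**: `H⁰(G, M_G^S(A)) → H⁰(S, A)` is injective
(`M_G^S(A)^G` consists of the constant functions with `S`-invariant value, and `sh` reads off that
value: `H⁰(G, M_G^S(A)) = A^S = H⁰(S, A)`). [cite: SerreGaloisCohomology1997, I §2.5 Prop. 10] -/
theorem shapiro_map_zero_injective :
    Function.Injective (ContinuousCohomology.map (subgroupIncl S) (coindEvalOne σ) 0).hom := by
  rw [injective_iff_map_eq_zero]
  intro y hy
  obtain ⟨c, hc, rfl⟩ :=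
    cxClass_surjective (homogeneousCochains (coindRep (G := G) σ).toTopRep) 0 1 (up_nat_next 0) y
  -- the image class is the class of the `0`-cochain `sh c`, which must then vanish (`d : C⁰ → C⁰`
  -- is zero)
  change (HomologicalComplex.homologyMap (shCochains σ) 0) (cxClass _ 0 1 (up_nat_next 0) c hc) = 0
    at hy
  rw [homologyMap_cxClass (shCochains σ) 0 1 (up_nat_next 0) c hc _
      (by rw [hom_f_d_apply (shCochains σ) 0 1 c, hc, hom_f_apply_zero]) rfl,
    cxClass_eq_zero_iff _ 0 1 (up_nat_next 0) 0 CochainComplex.prev_nat_zero] at hy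
  obtain ⟨z, hz⟩ := hy
  have hsh0 : (shCochains σ).f 0 c = 0 := by
    rw [← hz, (homogeneousCochains σ.toTopRep).shape 0 0 (by simp)]
    rfl
  -- `c` is a `0`-cocycle: constant with `G`-invariant value `F ∈ M_G^S(A)`, itself constant `= b`
  obtain ⟨F, hF, hcF⟩ := (cochains_d_zero_eq_zero_iff (coindRep σ).toTopRep c).1 hc
  obtain ⟨b, -, hFb⟩ := (coindRep_mem_invariants_iff σ F).1 hF
  -- `sh c` at `1 ∈ S` is `F(1) = b`, so `b = 0`, `F = 0`, `c = 0`
  have hb : b = 0 := by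
    have h1 := shCochains_zero_apply σ c 1
    rw [hsh0, hcF, ContinuousMap.const_apply, hFb, ContinuousMap.const_apply] at h1
    exact h1.symm
  have hc0 : c = 0 := by
    apply Subtype.ext
    rw [hcF]
    have hF0 : F = 0 := Subtype.ext (by rw [hFb, hb]; rfl)
    rw [hF0]
    rfl
  subst hc0
  exact (cxClass_eq_zero_iff _ 0 1 (up_nat_next 0) 0 CochainComplex.prev_nat_zero 0 hc).2
    ⟨0, map_zero _⟩

/-- **Shapiro injectivity, all degrees**: `sh : Hⁿ(G, M_G^S(A)) → Hⁿ(S, A)` is injective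
(degree `0`: `shapiro_map_zero_injective`; degrees `≥ 1`: `ShapiroInjective.map_shapiro_eq_zero_imp`).
[cite: SerreGaloisCohomology1997, I §2.5 Prop. 10] [cite: Shatz1972, Ch. II §2 Thm. 8] -/
theorem shapiro_map_injective (n : ℕ) :
    Function.Injective (ContinuousCohomology.map (subgroupIncl S) (coindEvalOne σ) n).hom := by
  cases n with
  | zero => exact shapiro_map_zero_injective σ
  | succ n =>
    rw [injective_iff_map_eq_zero]
    exact fun y hy ↦ map_shapiro_eq_zero_imp σ n y hy

/-- **Shapiro surjectivity, all degrees**: `sh : Hⁿ(G, M_G^S(A)) → Hⁿ(S, A)` is surjective — it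
retracts the map induced by the extension cochain map `ext` attached to a continuous equivariant
retraction `r : G → S` (Serre I §1.2 Prop. 1), `sh ∘ ext = id`
(`CohomologicalDimensionProofs.extCochainsMap_comp_cochainsMap`).
[cite: SerreGaloisCohomology1997, I §2.5 Prop. 10] [cite: SerreGaloisCohomology1997, I §1.2 Prop. 1] -/
theorem shapiro_map_surjective (n : ℕ) :
    Function.Surjective (ContinuousCohomology.map (subgroupIncl S) (coindEvalOne σ) n).hom := by
  haveI : CompactSpace S := compactSpace_of_isClosed_subgroup
  obtain ⟨r, hr, hrS⟩ := exists_continuousMap_mul_eq S hS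
  let Λ₀ : σ.toTopRep.ρ.coindV (subgroupIncl S) →L[ℤ] ((coindRep σ).toTopRep : Type u) :=
    { toFun := fun φ => φ
      map_add' := fun _ _ => rfl
      map_smul' := fun _ _ => rfl
      cont := continuous_id }
  have hcomp : HomologicalComplex.homologyMap
        (extCochainsMap (Y := σ.toTopRep) (coindRep σ).toTopRep hr Λ₀ (fun _ _ => rfl)) n ≫
      ContinuousCohomology.map (subgroupIncl S) (coindEvalOne σ) n = 𝟙 _ := by
    rw [ContinuousCohomology.map, ← HomologicalComplex.homologyMap_comp,
      extCochainsMap_comp_cochainsMap (Y := σ.toTopRep) (coindRep σ).toTopRep hr Λ₀ (fun _ _ => rfl)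
        (coindEvalOne σ) (fun _ => rfl) hrS,
      HomologicalComplex.homologyMap_id]
  intro x
  exact ⟨(HomologicalComplex.homologyMap
      (extCochainsMap (Y := σ.toTopRep) (coindRep σ).toTopRep hr Λ₀ (fun _ _ => rfl)) n).hom x,
    by simpa using congr_arg (fun φ => φ.hom x) hcomp⟩

/-- **Shapiro's lemma (Serre I §2.5 Prop. 10)**: `sh : Hⁿ(G, M_G^S(A)) → Hⁿ(S, A)` is bijective in
every degree, for a closed subgroup `S` of a profinite group `G` and a discrete `S`-module `A`.
[cite: SerreGaloisCohomology1997, I §2.5 Prop. 10] [cite: Shatz1972, Ch. II §2 Thm. 8] -/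
theorem shapiro_map_bijective (n : ℕ) :
    Function.Bijective (ContinuousCohomology.map (subgroupIncl S) (coindEvalOne σ) n).hom :=
  ⟨shapiro_map_injective σ n, shapiro_map_surjective σ n⟩

/-- **The Shapiro isomorphism `Hⁿ(G, M_G^S(A)) ≃+ Hⁿ(S, A)`** (Serre I §2.5 Prop. 10:
"`H^q(G, M_G^H(A)) = H^q(H, A)`", induced by `a* ↦ a*(1)` and the inclusion `H ↪ G`).
[cite: SerreGaloisCohomology1997, I §2.5 Prop. 10] [cite: Shatz1972, Ch. II §2 Thm. 8] -/
def shapiroAddEquiv (n : ℕ) :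
    (continuousCohomology n (coindRep (G := G) σ).toTopRep : Type u) ≃+
      (continuousCohomology n σ.toTopRep : Type u) :=
  AddEquiv.ofBijective
    (ContinuousCohomology.map (subgroupIncl S) (coindEvalOne σ) n).hom.toLinearMap.toAddMonoidHom
    (shapiro_map_bijective σ n)

/-- Unfolding: `shapiroAddEquiv` is the Shapiro map `ContinuousCohomology.map (S ↪ G) (coindEvalOne σ) n`.
[cite: SerreGaloisCohomology1997, I §2.5 Prop. 10] -/
@[simp] theorem shapiroAddEquiv_apply (n : ℕ) (x : continuousCohomology n (coindRep (G := G) σ).toTopRep) :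
    shapiroAddEquiv σ n x = (ContinuousCohomology.map (subgroupIncl S) (coindEvalOne σ) n).hom x :=
  rfl

/-- **Serre I §2.5 Prop. 10, `Nonempty` form**: `Hⁿ(G, M_G^S(A)) ≃+ Hⁿ(S, A)` for every `n`.
[cite: SerreGaloisCohomology1997, I §2.5 Prop. 10] [cite: Shatz1972, Ch. II §2 Thm. 8] -/
theorem nonempty_continuousCohomology_coindRep_addEquiv (n : ℕ) :
    Nonempty ((continuousCohomology n (coindRep (G := G) σ).toTopRep : Type u) ≃+
      (continuousCohomology n σ.toTopRep : Type u)) :=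
  ⟨shapiroAddEquiv σ n⟩

end Literature.NumberTheory.GaloisRepresentations

end
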